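import Literature.NumberTheory.LFunctions.ColossallyAbundantStructure
import Mathlib.Data.Nat.Factorization.Induction
import HarnessLib

/-!
# The envelope `σ(m)/m^{1+ε} ≤ ∏_{q ≤ P} F_ε(q^{a_q})` from per-prime ratio tests (plan N1, step (d))

Topic: `Literature/NumberTheory/LFunctions` (provefact `Literature.NumberTheory.LFunctions.robin_iff`, the finite statement
`RobinAnalyticSharp.robinCA_below`). Alaoglu–Erdős 1944, §3: for `ε > 0` the function
`G_ε(m) = σ(m)/m^{1+ε}` is multiplicative and attains its maximum at the (colossally abundant)
number `N_ε = ∏_q q^{a_q(ε)}`, where `a_q` maximises `b ↦ F_ε(q^b)`; here `F_ε = Nat.sigmaRpow ε`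
(`ColossallyAbundantStructure.lean`, tied to `Nat.IsCAParameter` by `Nat.isCAParameter_iff_sigmaRpow`).
Robin's interpolation argument (Robin 1984, §3 Prop. 1; `RobinCriterion.lean`) only needs the
**envelope** `σ(m)/m ≤ F_ε(N_ε) m^ε` for all `m`; this file PROVES it in the form that a kernel
computation can feed — the maximality of each `a_q` is reduced to two inequalities on the
consecutive ratios `r_ε(q, b) = σ(q^{b+1})/(σ(q^b) q^{1+ε})`, which are monotone in `b`
(`Nat.CA55440.G_le` in `ColossallyAbundant55440.lean` is the `ε = 1/30` instance of this
multiplicativity + tail + envelope argument, and `ColossallyAbundantQuotient.lean` /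
`ColossallyAbundantExponents.lean` prove the converse direction maximality ⟹ ratio inequalities):

* `ratio_succ_le`, `ratio_antitone` — `r(q, b+1) ≤ r(q, b)` (`σ(q^{b+2})σ(q^b) ≤ σ(q^{b+1})²`);
* `sigmaRpow_pow_le_of_ratio` — **ratio test**: `r(q, a−1) ≥ 1` (or `a = 0`) and `r(q, a) ≤ 1` imply
  `F(q^b) ≤ F(q^a)` for all `b`; `sigmaRpow_pow_le_one_of_ratio` — `r(q,0) ≤ 1` implies `F(q^b) ≤ 1`;
* `ratio_zero`, `succ_div_rpow_antitone` — `r(q, 0) = (q+1)/q^{1+ε}` is non-increasing in `q`, so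
  the tail test at one point covers all larger primes; more generally `ratioF_antitone`: the ratio
  as a function of a real variable, `ρ_ε(x, j) = g_{j+1}(x)/(g_j(x) x^{1+ε})` (`g_j(x) = ∑_{i≤j} x^i`,
  `= r_ε(q, j)` at primes, `ratio_eq_ratioF`), is non-increasing on `[1, ∞)`, so that ratio tests
  at the two ends of a level of consecutive table entries cover every prime of the level;
* `sigmaRpow_le_prod` — **the envelope**: if every prime `q ≤ P` passes the ratio test with exponent `a_q`
  and every prime `q > P` has `F(q^b) ≤ 1`, then `F_ε(m) ≤ ∏_{q ∈ primesLE P} F_ε(q^{a_q})` for all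
  `m ≥ 1` (this needs **all** primes `≤ P`: completeness of the prime table, `PrimeTable.lean`).

## References

* L. Alaoglu, P. Erdős, *On highly composite and similar numbers*, Trans. AMS 56 (1944), 448–469,
  §3. [AlaogluErdos1944]
* G. Robin, J. Math. Pures Appl. 63 (1984), 187–213, §3 Prop. 1. [Robin1984]
-/
noncomputable section

open Finset Real
open scoped ArithmeticFunction.sigma

namespace Literature.NumberTheory.LFunctions.Envelope

/-- The ratio `r_ε(q, b) = F(q^{b+1})/F(q^b) = σ(q^{b+1})/(σ(q^b) q^{1+ε})` (`F = Nat.sigmaRpow ε`). [folklore] -/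
def ratio (ε : ℝ) (q b : ℕ) : ℝ := (σ 1 (q ^ (b + 1)) : ℝ) / ((σ 1 (q ^ b) : ℝ) * (q : ℝ) ^ (1 + ε))

variable {ε : ℝ}

/-- Auxiliary (proof-internal). [folklore] -/
theorem sigmaRpow_nonneg (ε : ℝ) (m : ℕ) : 0 ≤ Nat.sigmaRpow ε m := by unfold Nat.sigmaRpow; positivity

/-- Auxiliary (proof-internal). [folklore] -/
theorem sigmaRpow_pow_zero (ε : ℝ) (q : ℕ) : Nat.sigmaRpow ε (q ^ 0) = 1 := by simp [Nat.sigmaRpow]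

/-- `F_ε = Nat.sigmaRpow ε` is multiplicative. [folklore] -/
theorem sigmaRpow_mul (ε : ℝ) {m n : ℕ} (h : Nat.Coprime m n) : Nat.sigmaRpow ε (m * n) = Nat.sigmaRpow ε m * Nat.sigmaRpow ε n := by
  unfold Nat.sigmaRpow
  rw [ArithmeticFunction.isMultiplicative_sigma.map_mul_of_coprime h, Nat.cast_mul, Nat.cast_mul,
    mul_rpow (Nat.cast_nonneg _) (Nat.cast_nonneg _)]
  ring

/-- `F(m) = ∏_{q^k ‖ m} F(q^k)`. [folklore] -/
theorem sigmaRpow_eq_prod (ε : ℝ) {m : ℕ} (hm : m ≠ 0) :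
    Nat.sigmaRpow ε m = ∏ q ∈ m.primeFactors, Nat.sigmaRpow ε (q ^ m.factorization q) := by
  rw [Nat.multiplicative_factorization (Nat.sigmaRpow ε) (fun _ _ h => sigmaRpow_mul ε h) (Nat.sigmaRpow_one ε) hm, Finsupp.prod,
    Nat.support_factorization]

/-- `σ(q^b) > 0`. [folklore] -/
theorem sigma_pow_pos {q : ℕ} (hq : q.Prime) (b : ℕ) : (0 : ℝ) < σ 1 (q ^ b) := by
  have : 0 < σ 1 (q ^ b) := ArithmeticFunction.sigma_pos 1 _ (pow_ne_zero _ hq.ne_zero)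
  exact_mod_cast this

/-- The recursion `σ(q^{b+1}) = q σ(q^b) + 1`. [folklore] -/
theorem sigma_pow_succ {q : ℕ} (hq : q.Prime) (b : ℕ) :
    (σ 1 (q ^ (b + 1)) : ℝ) = q * σ 1 (q ^ b) + 1 := by
  rw [ArithmeticFunction.sigma_one_apply_prime_pow hq, ArithmeticFunction.sigma_one_apply_prime_pow hq,
    Finset.sum_range_succ']
  push_cast
  rw [Finset.mul_sum]
  congr 1
  refine Finset.sum_congr rfl fun i _ => ?_
  ring

/-- `F(q^{b+1}) = F(q^b) · r(q, b)`. [folklore] -/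
theorem sigmaRpow_pow_succ {q : ℕ} (hq : q.Prime) (b : ℕ) : Nat.sigmaRpow ε (q ^ (b + 1)) = Nat.sigmaRpow ε (q ^ b) * ratio ε q b := by
  have hq0 : (0 : ℝ) < q := by exact_mod_cast hq.pos
  have hs := sigma_pow_pos hq b
  unfold Nat.sigmaRpow ratio
  have e : ((q ^ (b + 1) : ℕ) : ℝ) ^ (1 + ε) = ((q ^ b : ℕ) : ℝ) ^ (1 + ε) * (q : ℝ) ^ (1 + ε) := by
    push_cast
    rw [pow_succ, mul_rpow (by positivity) hq0.le]
  rw [e]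
  field_simp

/-- **The ratio decreases in `b`**: `σ(q^{b+2}) σ(q^b) ≤ σ(q^{b+1})²`. [folklore] -/
theorem ratio_succ_le {q : ℕ} (hq : q.Prime) (b : ℕ) : ratio ε q (b + 1) ≤ ratio ε q b := by
  have hq0 : (0 : ℝ) < q := by exact_mod_cast hq.pos
  have hs0 := sigma_pow_pos hq b
  have hs1 := sigma_pow_pos hq (b + 1)
  have e1 := sigma_pow_succ hq b
  have e2 := sigma_pow_succ hq (b + 1)
  unfold ratio
  rw [div_le_div_iff₀ (by positivity) (by positivity), e2, e1]
  have hq1 : (1 : ℝ) ≤ q := by exact_mod_cast hq.one_lt.le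
  have hmono : (σ 1 (q ^ b) : ℝ) ≤ σ 1 (q ^ (b + 1)) := by
    rw [e1]; nlinarith [mul_nonneg (sub_nonneg.2 hq1) hs0.le]
  have hpow : 0 < (q : ℝ) ^ (1 + ε) := by positivity
  nlinarith [mul_le_mul_of_nonneg_left hmono hpow.le]

/-- The ratio is antitone in `b`. [folklore] -/
theorem ratio_antitone {q : ℕ} (hq : q.Prime) {b c : ℕ} (h : b ≤ c) : ratio ε q c ≤ ratio ε q b := by
  induction h with
  | refl => exact le_rfl
  | step _ ih => exact (ratio_succ_le hq _).trans ih

/-- Auxiliary (proof-internal). [folklore] -/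
theorem ratio_pos {q : ℕ} (hq : q.Prime) (b : ℕ) : 0 < ratio ε q b := by
  unfold ratio
  have := sigma_pow_pos hq b; have := sigma_pow_pos hq (b + 1)
  have hq0 : (0 : ℝ) < q := by exact_mod_cast hq.pos
  positivity

/-- **Unimodality (ratio test)**: if `r(q, a−1) ≥ 1` (or `a = 0`) and `r(q, a) ≤ 1`, then `a`
maximises `b ↦ F(q^b)`. [cite: AlaogluErdos1944, §3 (the exponents of a colossally abundant number)] -/
theorem sigmaRpow_pow_le_of_ratio {q : ℕ} (hq : q.Prime) {a : ℕ} (hup : a = 0 ∨ 1 ≤ ratio ε q (a - 1))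
    (hdown : ratio ε q a ≤ 1) : ∀ b : ℕ, Nat.sigmaRpow ε (q ^ b) ≤ Nat.sigmaRpow ε (q ^ a) := by
  -- decreasing beyond `a`
  have hdec : ∀ n : ℕ, Nat.sigmaRpow ε (q ^ (a + n)) ≤ Nat.sigmaRpow ε (q ^ a) := by
    intro n
    induction n with
    | zero => exact le_rfl
    | succ n ih =>
      rw [show a + (n + 1) = (a + n) + 1 by ring, sigmaRpow_pow_succ hq]
      have hr : ratio ε q (a + n) ≤ 1 := (ratio_antitone hq (Nat.le_add_right a n)).trans hdown
      have h0 := sigmaRpow_nonneg ε (q ^ (a + n))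
      calc Nat.sigmaRpow ε (q ^ (a + n)) * ratio ε q (a + n) ≤ Nat.sigmaRpow ε (q ^ (a + n)) * 1 :=
            mul_le_mul_of_nonneg_left hr h0
        _ ≤ Nat.sigmaRpow ε (q ^ a) := by rw [mul_one]; exact ih
  -- increasing up to `a`
  have hstep : ∀ c : ℕ, c < a → Nat.sigmaRpow ε (q ^ c) ≤ Nat.sigmaRpow ε (q ^ (c + 1)) := by
    intro c hc
    rw [sigmaRpow_pow_succ hq]
    have hr : 1 ≤ ratio ε q c := by
      rcases hup with h0 | h1
      · omega
      · exact h1.trans (ratio_antitone hq (by omega))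
    have h0 := sigmaRpow_nonneg ε (q ^ c)
    nlinarith
  have hinc : ∀ d b : ℕ, b + d = a → Nat.sigmaRpow ε (q ^ b) ≤ Nat.sigmaRpow ε (q ^ a) := by
    intro d
    induction d with
    | zero => intro b hb; rw [← hb]; simp
    | succ d ih =>
      intro b hb
      exact (hstep b (by omega)).trans (ih (b + 1) (by omega))
  intro b
  rcases le_or_gt b a with h | h
  · exact hinc (a - b) b (by omega)
  · obtain ⟨n, rfl⟩ := Nat.exists_eq_add_of_lt h
    rw [show a + n + 1 = a + (n + 1) by ring]
    exact hdec (n + 1)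

/-- **Tail**: if `r(q, 0) ≤ 1` then `F(q^b) ≤ 1` for all `b`. [folklore] -/
theorem sigmaRpow_pow_le_one_of_ratio {q : ℕ} (hq : q.Prime) (h : ratio ε q 0 ≤ 1) (b : ℕ) : Nat.sigmaRpow ε (q ^ b) ≤ 1 := by
  have := sigmaRpow_pow_le_of_ratio hq (a := 0) (Or.inl rfl) h b
  rwa [sigmaRpow_pow_zero] at this

/-- `r(q, 0) = (q + 1)/q^{1+ε}`. [folklore] -/
theorem ratio_zero {q : ℕ} (hq : q.Prime) : ratio ε q 0 = ((q : ℝ) + 1) / (q : ℝ) ^ (1 + ε) := by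
  unfold ratio
  rw [zero_add, pow_one, pow_zero]
  have h1 : (σ 1 q : ℝ) = q + 1 := by
    rw [ArithmeticFunction.sigma_one_apply, Nat.Prime.divisors hq, Finset.sum_pair hq.one_lt.ne]
    push_cast; ring
  have h2 : (σ 1 1 : ℝ) = 1 := by simp
  rw [h1, h2, one_mul]

/-- `q ↦ (q+1)/q^{1+ε}` is non-increasing on `[1, ∞)` (`ε ≥ 0`): the tail test at one point `q₀`
covers all larger primes. [folklore] -/
theorem succ_div_rpow_antitone (hε : 0 ≤ ε) {x y : ℝ} (hx : 1 ≤ x) (hxy : x ≤ y) :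
    (y + 1) / y ^ (1 + ε) ≤ (x + 1) / x ^ (1 + ε) := by
  have hx0 : 0 < x := by linarith
  have hy0 : 0 < y := by linarith
  -- `(t+1)/t^{1+ε} = (1 + 1/t) · t^{-ε}`, both factors non-increasing
  have e : ∀ t : ℝ, 0 < t → (t + 1) / t ^ (1 + ε) = (1 + t⁻¹) * t ^ (-ε) := by
    intro t ht
    rw [rpow_add ht, rpow_one, rpow_neg ht.le]
    field_simp
  rw [e x hx0, e y hy0]
  have h1 : 1 + y⁻¹ ≤ 1 + x⁻¹ := by
    have := inv_anti₀ hx0 hxy; linarith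
  have h2 : y ^ (-ε) ≤ x ^ (-ε) := rpow_le_rpow_of_nonpos hx0 hxy (by linarith)
  exact mul_le_mul h1 h2 (by positivity) (by positivity)

/-- **The envelope.** If every prime `q ≤ P` has an exponent `a_q` maximising `b ↦ F(q^b)` and every
prime `q > P` has `F(q^b) ≤ 1` for all `b`, then `F(m) ≤ ∏_{q ≤ P} F(q^{a_q})` for every `m ≥ 1`.
[cite: AlaogluErdos1944, §3; Robin1984, §3 Prop. 1 (use)] -/
theorem sigmaRpow_le_prod {P : ℕ} {a : ℕ → ℕ}
    (hmax : ∀ q : ℕ, q.Prime → q ≤ P → ∀ b : ℕ, Nat.sigmaRpow ε (q ^ b) ≤ Nat.sigmaRpow ε (q ^ (a q)))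
    (htail : ∀ q : ℕ, q.Prime → P < q → ∀ b : ℕ, Nat.sigmaRpow ε (q ^ b) ≤ 1) {m : ℕ} (hm : m ≠ 0) :
    Nat.sigmaRpow ε m ≤ ∏ q ∈ Nat.primesLE P, Nat.sigmaRpow ε (q ^ (a q)) := by
  classical
  rw [sigmaRpow_eq_prod ε hm]
  set h : ℕ → ℝ := fun q => if q ≤ P then Nat.sigmaRpow ε (q ^ (a q)) else 1 with hh
  have hle : ∀ q ∈ m.primeFactors, Nat.sigmaRpow ε (q ^ m.factorization q) ≤ h q := by
    intro q hq
    have hqp : q.Prime := Nat.prime_of_mem_primeFactors hq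
    by_cases hqP : q ≤ P
    · simp only [hh, if_pos hqP]; exact hmax q hqp hqP _
    · simp only [hh, if_neg hqP]; exact htail q hqp (not_le.1 hqP) _
  have h1 : ∏ q ∈ m.primeFactors, Nat.sigmaRpow ε (q ^ m.factorization q) ≤ ∏ q ∈ m.primeFactors, h q :=
    Finset.prod_le_prod (fun q _ => sigmaRpow_nonneg ε _) hle
  refine h1.trans ?_
  -- drop the factors `q > P` (equal to `1`) and enlarge to all primes `≤ P` (factors `≥ 1`)
  have h2 : ∏ q ∈ m.primeFactors, h q = ∏ q ∈ m.primeFactors.filter (· ≤ P), Nat.sigmaRpow ε (q ^ (a q)) := by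
    simp only [hh, Finset.prod_filter]
  rw [h2]
  set s := m.primeFactors.filter (· ≤ P) with hs
  have hsub : s ⊆ Nat.primesLE P := by
    intro q hq
    rw [hs, Finset.mem_filter] at hq
    exact Nat.mem_primesLE.2 ⟨hq.2, Nat.prime_of_mem_primeFactors hq.1⟩
  rw [← Finset.prod_sdiff hsub]
  have hone : 1 ≤ ∏ q ∈ Nat.primesLE P \ s, Nat.sigmaRpow ε (q ^ (a q)) := by
    refine Finset.prod_induction _ (fun x => 1 ≤ x) (fun x y hx hy => one_le_mul_of_one_le_of_one_le hx hy)
      le_rfl fun q hq => ?_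
    have hq' := (Finset.mem_sdiff.1 hq).1
    have hqp : q.Prime := (Nat.mem_primesLE.1 hq').2
    have := hmax q hqp (Nat.mem_primesLE.1 hq').1 0
    rwa [sigmaRpow_pow_zero] at this
  have hnn : 0 ≤ ∏ q ∈ s, Nat.sigmaRpow ε (q ^ (a q)) := Finset.prod_nonneg fun q _ => sigmaRpow_nonneg ε _
  exact le_mul_of_one_le_left hnn hone

/-! ### The ratio as a function of a real variable (checks at composite table points) -/

/-- `g_j(x) = ∑_{i ≤ j} x^i`, Mathlib's geometric sum `∑ i ∈ range (j+1), x ^ i` under a local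
name (`= σ(q^j)` at a prime `q`). [folklore] -/
def geomSum (x : ℝ) (j : ℕ) : ℝ := ∑ i ∈ range (j + 1), x ^ i

/-- `ρ_ε(x, j) = g_{j+1}(x)/(g_j(x) x^{1+ε})`, the ratio as a function of a real variable. [folklore] -/
def ratioF (ε x : ℝ) (j : ℕ) : ℝ := geomSum x (j + 1) / (geomSum x j * x ^ (1 + ε))

/-- `g_{j+1}(x) = x g_j(x) + 1`. [folklore] -/
theorem geomSum_succ (x : ℝ) (j : ℕ) : geomSum x (j + 1) = x * geomSum x j + 1 := by
  unfold geomSum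
  rw [Finset.sum_range_succ', Finset.mul_sum]
  simp [pow_succ, mul_comm]

/-- `g_j(x) ≥ 1` for `x ≥ 0`. [folklore] -/
theorem one_le_geomSum {x : ℝ} (hx : 0 ≤ x) (j : ℕ) : 1 ≤ geomSum x j := by
  unfold geomSum
  rw [Finset.sum_range_succ']
  have : 0 ≤ ∑ i ∈ range j, x ^ (i + 1) := Finset.sum_nonneg fun i _ => by positivity
  simp only [pow_zero]; linarith

/-- `g_j` is non-decreasing on `[0, ∞)`. [folklore] -/
theorem geomSum_mono {x y : ℝ} (hx : 0 ≤ x) (hxy : x ≤ y) (j : ℕ) : geomSum x j ≤ geomSum y j := by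
  unfold geomSum
  exact Finset.sum_le_sum fun i _ => pow_le_pow_left₀ hx hxy i

/-- At a prime, `σ(q^j) = g_j(q)` and `r_ε(q, j) = ρ_ε(q, j)`. [folklore] -/
theorem ratio_eq_ratioF (ε : ℝ) {q : ℕ} (hq : q.Prime) (j : ℕ) : ratio ε q j = ratioF ε q j := by
  unfold ratio ratioF geomSum
  rw [ArithmeticFunction.sigma_one_apply_prime_pow hq, ArithmeticFunction.sigma_one_apply_prime_pow hq]
  push_cast
  rfl

/-- **`ρ_ε(·, j)` is non-increasing on `[1, ∞)`** (`ε ≥ 0`): `ρ = x^{−ε} + 1/(g_j(x) x^{1+ε})`. Hence a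
ratio test `ρ ≤ 1` checked at the smallest member of a level covers the whole level, and `ρ ≥ 1`
checked at the largest member covers it too. [folklore] -/
theorem ratioF_antitone {ε : ℝ} (hε : 0 ≤ ε) {x y : ℝ} (hx : 1 ≤ x) (hxy : x ≤ y) (j : ℕ) :
    ratioF ε y j ≤ ratioF ε x j := by
  have hx0 : 0 < x := by linarith
  have hy0 : 0 < y := by linarith
  have e : ∀ t : ℝ, 0 < t → ratioF ε t j = t ^ (-ε) + (geomSum t j * t ^ (1 + ε))⁻¹ := by
    intro t ht
    have hg : 0 < geomSum t j := lt_of_lt_of_le one_pos (one_le_geomSum ht.le j)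
    unfold ratioF
    rw [geomSum_succ, rpow_add ht, rpow_one, rpow_neg ht.le]
    field_simp
  rw [e x hx0, e y hy0]
  have h1 : y ^ (-ε) ≤ x ^ (-ε) := rpow_le_rpow_of_nonpos hx0 hxy (by linarith)
  have hgx : 0 < geomSum x j := lt_of_lt_of_le one_pos (one_le_geomSum hx0.le j)
  have h2 : (geomSum y j * y ^ (1 + ε))⁻¹ ≤ (geomSum x j * x ^ (1 + ε))⁻¹ := by
    apply inv_anti₀ (by positivity)
    exact mul_le_mul (geomSum_mono hx0.le hxy j) (rpow_le_rpow hx0.le hxy (by linarith))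
      (by positivity) (by linarith [one_le_geomSum hy0.le j])
  linarith


end Literature.NumberTheory.LFunctions.Envelope
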